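import Literature.MathematicalPhysics.QuantumFieldTheory.Balaban1983to89.B9Thm313WholeDvHolderFromDds
import Literature.MathematicalPhysics.QuantumFieldTheory.Balaban1983to89.B9GradViaDivLettersAtPinsHolder

/-!
# `Balaban1983to89.B9Thm313WholeDvHolderAtPins` — [B9] Theorems 3.12–3.13 (pp. 420–426): THE FOUR HÖLDER-SOURCE LETTER FIELDS OF ROWS 20–21 AT THE N06
# CERTIFICATE'S PINS — `B9Thm313WholeDvHolderFromDds` (the algebra) ∘ `B9GradViaDivLettersAtPinsHolder` (the Hölder letter of `J_μ` at node00-def-Y's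
# `DvcoKH`): `Thm33G0DivR.h44DsDv`, `Letters313DMZ.dgDHd`, `Letters313DZ.dgDH`, `Letters313HZ.pYDH` for every member and every `Reg335` configuration IN
# SMALL-GAUGE POSITION, from the derived `Thm33G0Dir.h44m ∕ h45m` and the directional `h44Ds` — ONE binder `hΘ` on `U` in place of four displayed Hölder fields

T. Bałaban, *Propagators for lattice gauge theories in a background field*, Commun. Math. Phys. **99** (1985) 389–434
[`Balaban1985BackgroundPropagators`, "B9"]; [4] = T. Bałaban, *Propagators and renormalization transformations for lattice gauge
theories. II*, Commun. Math. Phys. **96** (1984) 223–250 [`Balaban1984PropagatorsII`].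

statement-level skeleton of published theorems with citation tags; proofs where landed; nothing here is a claim about the Yang–Mills
mass gap

THE POINT.  The consumable form for the knit (dag-n06-d), in the pattern of g17's `B9Thm313WholeDvAtPins`: at a `B9Thm312Whole.Ops` record over a member `x`
whose block maps and letters are pinned to n06-d's carriers and def-Y's models (`hblk12 ∕ hblkY12 ∕ hDvco12 ∕ hDco12`, `h𝔡Ad ∕ h𝔡As`), with `bI` 1-faithful and
direction-blind (`hβ1`, `hbI0`), `U ∈ Reg335` (contracting links) and the small-field-gauge binder
  `hΘ : ∀ μ s s′, Adm ⟨s,μ⟩ ⟨s′,μ⟩ → t(⟨s,μ⟩,⟨s′,μ⟩)^{−ε}·‖U_μ(s) − U_μ(s′)‖ ≤ ϑ`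
(the ξ-scale ε-Hölder datum of the link field — NOT a consequence of `Reg335`, see `B9GradViaDivLettersAtPinsHolder`'s LOCATED note):
* §0 ★ `hasMaj_sliceProjK_cNorm` — the sup-class letter of the direction-slice projector `Π_ν` between the state norms 𝔠⁽ⁿ⁾ (kernel `1·e^{−δd}`, any δ; the sup
  twin of p612710's `blockBd_sliceProjK`), over `hasMajorantHom_sliceProjK`;
* §1 ★★ `h44DsDv_pins` — `Thm33G0DivR.h44DsDv ε` at the pinned input classes `bHX x ε = bHS (sIK bI) ε`, `bHXA x ε = bHK bI ε` from the directional
  `h44Ds · ε` (`0 < ε ≤ 1`) and `hasMaj_JcoKH_holder_pins`: `B_dD ≥ (d+1)·B_iD·C_J(ϑ)·c`, `C_J(ϑ) = 2(1+ϑ)·cR39 (trBasis N)·e^{δ_J·rJ}`;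
  ★★ `dgDHd_pins` — `Letters313DMZ.dgDHd ν` with the free class PINNED to `bH13 := weightNorm (bHS (sIK bI) 1) (Lʲη)⁻¹` (n06-w6's suggested pin; ε = 1 so that
  the same class feeds `pXdDH ∀ β < 1`), from the derived `Thm33G0Dir.h44m (ν, μ) 1` and `hasMaj_JcoKH_holder_len` (member facts `Facts347`):
  `B₃ ≥ (d+1)·κ₀·B_i·L₀·C_J(ϑ)·L·c`, `δ₃ ≤ δ₀ − αδ_F`, `δ₃ + σ ≤ δ_J − αδ_F`; ★★ `dgDH_pins` — `Letters313DZ.dgDH` with def-Y's slice-diagonal `DcoK`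
  (`DcoK_eq_sum`) and the Π-letter: `B₃p ≥ (d+1)·B₃·c`, same rate; ★★ `pYDH_pins` — `Letters313HZ.pYDH β` with the same `bH13`, from a directional
  Φ^Y-(3.45) member at the input class `bHK bI 1` (`h45Y`; at the pins = n06-w6's `B9Thm33G0ProbeYFromDirAtPins.h45Y_of_thm33G0Dir_pins … μ (1−β) β`
  after `β + (1 − β) = 1`) and `hasMaj_JcoKH_holder_len`: `BhD ≥ (d+1)·κ₀·B_i·L₀·C_J(ϑ)·L·c`.
NOT HERE: `Thm33G0DirX.pXdDH` (n06-w6's `pXdDH_of_h45m`, its `hJ` = `hasMaj_JcoKH_holder_len`).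

HONEST SCOPE.  Kernel bookkeeping over landed modules (composition only); `ϑ` is a HYPOTHESIS on `U`; nothing of print's estimates asserted; COUNT-NEUTRAL; N06
NOT discharged; one finite lattice at a time; nothing continuum, nothing about the mass gap.  Cell `pub-ymgap` (HUMAN RULING D-0062), Track A node N06 [B9],
rows 20–21 (bundle F7), seat `pub-ymgap-dag-n06-l` (g18), 2026-08-28.
-/

noncomputable section

namespace Literature.MathematicalPhysics.QuantumFieldTheory.Balaban1983to89.B9Thm313WholeDvHolderAtPins

open Node00 B6GlobalChartV1 B6KLevelCensusIndexV1 B9BackgroundsKLevelV1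
open B6Geom246MultiLevelTorus (geomT)
open B6Ineq2142KLevelV1 (β)
open B11SectG (HasMaj RowSum BlockNorm)
open B9Thm34Ext (toB6)
open B9SectDSup (weightNorm weightNorm_loc)
open B9Thm312Whole (cNorm wt wt_nonneg GeoOK Ops)
open B9Thm312WholeClasses (cNormR)
open B9RWSums343to347Whole (Facts347)
open B9Thm39ReadingCoords (cR39 cR39_nonneg)
open B9CoReadingCoords (XBK coordOpK cdBₗ cdsBₗ blkBK)
open B9CoReadingCoordsH (XHK)
open B9CoReadingCoordsS (XSK blkSK sIK)
open B9CoReadingCoordsInput (bHK)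
open B9CoReadingCoordsInputS (bHS)
open B9CoRealizesRelAtLetters (RelB)
open B9CoReadingCoordsTranspose (TrIdx trBasis)
open B9PinMembersKLevelV1 (MemberY geo9Y bg9Y)
open B7Prop2SpecialUnitary (specialUnitaryUnits)
open Node00.OpsYSectDCoords (DvcoKH)
open B9GeoNormsKLevelV1 (geo9K)
open B9GeoLemma21KLevelV1 (geo9K_dist_self)
open B9GradViaDivLettersAtPins (JcoKH rJ sliceProjK sliceProjK_apply DvcoKH_eq_sum DcoK_eq_sum)
open B9GradViaDivLettersAtPinsHolder (hasMaj_JcoKH_holder_pins hasMaj_JcoKH_holder_len)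
open B9Thm313WholeDvHolderFromDds (h44DsDv_of_h44Ds dgDHd_of_h44m dgDH_of_h44m pYDH_of_h45Y)
open B9RWSums343Holder (HolderProbes)
open scoped Matrix.Norms.L2Operator

variable {d ℓ : ℕ} {hd : 1 ≤ d + 1} {hL : Odd (ℓ + 1) ∧ 1 < ℓ + 1} {b₀ b₁ : ℝ}

/-! ## §0 The sup-class letter of the direction-slice projector `Π_ν` (the `hPr` of `dgDH_of_h44m`) -/

section Proj

variable (i : KIdx d ℓ hd hL b₀ b₁) {κ : Type} [Fintype κ]

omit [Fintype κ] in
/-- **THE TWO-SPACE SUP MAJORANT OF `Π_ν`**: `|Π_νf(p)| ≤ |f(p)|`, so for `supp f ⊂ Δ(y′)` the kernel `[y = y′]` serves.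
[cite: Balaban1985BackgroundPropagators, (3.42) p.397 («∇_UG(U)», all directions); Balaban1984PropagatorsII, (2.51) p.232] -/
theorem hasMajorantHom_sliceProjK {R₀ : ℝ} {H₀ : Prop} [Fintype (geo9K i).Site] [DecidableEq (geo9K i).Site] (blk : XBK κ i → IBondY i) (ν : Fin (d + 1)) :
    B6RandomWalkHom.HasMajorantHom (g := toB6 (geo9K i) R₀ H₀) blk blk (sliceProjK (κ := κ) ν)
      (fun a a' : (geo9K i).Site => if a = a' then (1 : ℝ) else 0) := by
  intro y' f Bl hl p
  rw [sliceProjK_apply]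
  by_cases hp : blk p = y'
  · have hK : (fun a a' : (geo9K i).Site => if a = a' then (1 : ℝ) else 0) (blk p) y' = 1 := if_pos hp
    rw [hK, one_mul]
    split_ifs
    · exact hl.bound p hp
    · rw [abs_zero]; exact hl.nonneg
  · have hK : (fun a a' : (geo9K i).Site => if a = a' then (1 : ℝ) else 0) (blk p) y' = 0 := if_neg hp
    rw [hK, zero_mul]
    split_ifs
    · rw [hl.off p hp, abs_zero]
    · rw [abs_zero]

/-- ★ **THE SUP-CLASS LETTER OF `Π_ν`**: `Π_ν` does not increase the sharp-block sup and preserves supports, so between the state norms 𝔠⁽ⁿ⁾ of one block map it has the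
kernel `1·e^{−δd(y,y′)}` for every `δ` (`d(y,y) = 0`) — the sup twin of p612710's `blockBd_sliceProjK`, the `hPr` of `B9Thm313WholeDvHolderFromDds.dgDH_of_h44m`.
[cite: Balaban1985BackgroundPropagators, (3.42) p.397 («∇_UG(U)», all directions); Balaban1984PropagatorsII, (2.51)–(2.52) p.232] -/
theorem hasMaj_sliceProjK_cNorm {δ : ℝ} {R₀ : ℝ} {H₀ : Prop} [Fintype (geo9K i).Site] (blk : XBK κ i → IBondY i)
    (hlen : ∀ y : (geo9K i).Site, 0 ≤ (geo9K i).len y) (n : ℕ) (ν : Fin (d + 1)) :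
    HasMaj (cNorm R₀ H₀ blk hlen n) (cNorm R₀ H₀ blk hlen n) (sliceProjK (κ := κ) ν)
      (fun y y' => (1 : ℝ) * Real.exp (-(δ * (geo9K i).dist y y'))) := by
  classical
  have hK0 : ∀ a a' : (geo9K i).Site, 0 ≤ (if a = a' then (1 : ℝ) else 0) := fun a a' => by split_ifs <;> norm_num
  have h0 := B9Thm37AllNorms.hasMaj_of_hasMajorantHom (G := toB6 (geo9K i) R₀ H₀) blk blk hK0 (hasMajorantHom_sliceProjK i blk ν)
  show HasMaj (weightNorm (BlockNorm.ofBlocks (toB6 (geo9K i) R₀ H₀) blk) (wt (geo9K i) n) (wt_nonneg hlen n))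
    (weightNorm (BlockNorm.ofBlocks (toB6 (geo9K i) R₀ H₀) blk) (wt (geo9K i) n) (wt_nonneg hlen n)) _ _
  refine B9SectDSup.HasMaj.weight (wt_nonneg hlen n) (wt_nonneg hlen n) h0 fun y y' => ?_
  split_ifs with hy
  · subst hy
    change IBondY i at y
    rw [geo9K_dist_self, mul_zero, neg_zero, Real.exp_zero, mul_one, one_mul, one_mul]
  · rw [mul_zero]
    exact mul_nonneg (mul_nonneg zero_le_one (Real.exp_nonneg _)) (wt_nonneg hlen n y')

end Proj

/-! ## §1 The member-level corollaries at the certificate's pins -/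

section Members

variable {Mstar : ℕ} {N : ℕ} [NeZero N]
variable [∀ x : MemberY d ℓ hd hL b₀ b₁ Mstar, Fintype (geo9Y x).Site] [∀ x : MemberY d ℓ hd hL b₀ b₁ Mstar, DecidableRel (RelB x.toKIdx)]

omit [NeZero N] [∀ x : MemberY d ℓ hd hL b₀ b₁ Mstar, Fintype (geo9Y x).Site] [∀ x : MemberY d ℓ hd hL b₀ b₁ Mstar, DecidableRel (RelB x.toKIdx)] in
/-- `0 ≤ C_J(ϑ) = 2(1+ϑ)·cR39·e^{δ·rJ}` for `ϑ ≥ 0`. [cite: Balaban1985BackgroundPropagators, (3.48) p.398, bookkeeping] -/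
theorem constJH_nonneg {ϑ : ℝ} (hϑ : 0 ≤ ϑ) (δ : ℝ) : 0 ≤ 2 * (1 + ϑ) * cR39 (trBasis N) * Real.exp (δ * rJ d ℓ) := by
  have := cR39_nonneg (trBasis N); positivity

/-- ★★ **`Thm33G0DivR.h44DsDv ε` AT THE PINS FROM ITS DIRECTIONAL FIELD `h44Ds · ε`** — D\*G₀D_U : `bHX x ε = bHS (sIK bI) ε` → 𝔠_W⁽⁰⁾ for `0 < ε ≤ 1`, every member,
every `Reg335` configuration IN SMALL-GAUGE POSITION (`hΘ`), from `h44Ds μ ε` (D\*G₀∇\*_{U,μ} out of `bHXA x ε = bHK bI ε`) and the no-length Hölder J-letter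
(`B9GradViaDivLettersAtPinsHolder.hasMaj_JcoKH_holder_pins`); `B_dD ≥ (d+1)·B_iD·C_J(ϑ)·c`, `0 ≤ δ₃ ≤ δ₀`, `δ₃ + σ ≤ δ_J`.
[cite: Balaban1985BackgroundPropagators, Thm 3.3 (3.44) p.398 + (3.3) p.390 + (3.35) p.396 + p.398 (remarks after (3.47)); Balaban1984PropagatorsII, (2.26) p.228 + (2.52)–(2.56) pp.232–233 + Lemma 2.1 (2.61) p.234] -/
theorem h44DsDv_pins (x : MemberY d ℓ hd hL b₀ b₁ Mstar) {bI : FBondY x.toKIdx → IBondY x.toKIdx}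
    (hβ1 : ∀ f : FBondY x.toKIdx, (geomT x.D).dist (β x.hN x.D x.hk (bI f)) (blkV1 x.hN x.D f) ≤ 1)
    (hbI0 : ∀ f : FBondY x.toKIdx, bI f = bI ⟨f.src, 0⟩) {c35 α₀ : ℝ}
    {U : (bg9Y (Matrix (Fin N) (Fin N) ℂ) (specialUnitaryUnits (Fin N)) x).Cfg}
    (hU : (bg9Y (Matrix (Fin N) (Fin N) ℂ) (specialUnitaryUnits (Fin N)) x).Reg335 c35 α₀ U)
    {ε : ℝ} (hε : 0 ≤ ε) (hε1 : ε ≤ 1) {ϑ : ℝ} (hϑ : 0 ≤ ϑ)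
    (hΘ : ∀ (μ : Fin (d + 1)) (s s' : Site (PV d ℓ x.toKIdx.m x.toKIdx.K hd hL) 0), Adm x.toKIdx ⟨s, μ⟩ ⟨s', μ⟩ →
      tpar x.toKIdx ⟨s, μ⟩ ⟨s', μ⟩ ^ (-ε) * ‖(U μ s : Matrix (Fin N) (Fin N) ℂ) - (U μ s' : Matrix (Fin N) (Fin N) ℂ)‖ ≤ ϑ)
    {R₀ : ℝ} {H₀ : Prop} (hG : GeoOK (geo9Y x)) {σ c : ℝ} (hrow : RowSum (toB6 (geo9Y x) R₀ H₀) σ c)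
    (𝔬 : Ops (geo9Y x) (bg9Y (Matrix (Fin N) (Fin N) ℂ) (specialUnitaryUnits (Fin N)) x) (XBK (TrIdx N) x.toKIdx) (XBK (TrIdx N) x.toKIdx)
      (XHK (TrIdx N) x.toKIdx) (XSK (TrIdx N) x.toKIdx))
    (hDv : 𝔬.Dv U = DvcoKH x.toKIdx (trBasis N) (bg9Y (Matrix (Fin N) (Fin N) ℂ) (specialUnitaryUnits (Fin N)) x) (fun U => U) U)
    {Dds : Fin (d + 1) → Module.End ℝ (XBK (TrIdx N) x.toKIdx → ℝ)}
    (hDds : Dds = fun μ => coordOpK (trBasis N) (fun _ : Fin (d + 1) => cdsBₗ x.toKIdx U μ))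
    {BiD δ₀ δJ BdD δ₃ : ℝ} (hBiD : 0 ≤ BiD) (hδJ : 0 ≤ δJ) (hδ₃ : 0 ≤ δ₃) (hδ₃0 : δ₃ ≤ δ₀) (hδ₃J : δ₃ + σ ≤ δJ)
    (hBdD : ((d : ℝ) + 1) * (1 * BiD * (2 * (1 + ϑ) * cR39 (trBasis N) * Real.exp (δJ * rJ d ℓ)) * c) ≤ BdD)
    (h44Ds : ∀ μ, letI : Fintype (geo9K x.toKIdx).Site := (inferInstance : Fintype (geo9Y x).Site)
      HasMaj (bHK (κ := TrIdx N) (R := R₀) (H := H₀) x.toKIdx bI ε) (cNormR R₀ H₀ 𝔬.blkW hG.lenle 0) (𝔬.Dvstar U ∘ₗ (𝔬.G0 U ∘ₗ Dds μ))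
        (fun a b => BiD * Real.exp (-(δ₀ * (geo9Y x).dist a b)))) :
    letI : Fintype (geo9K x.toKIdx).Site := (inferInstance : Fintype (geo9Y x).Site)
    HasMaj (bHS (κ := TrIdx N) (R := R₀) (H := H₀) x.toKIdx (sIK x.toKIdx bI) ε) (cNormR R₀ H₀ 𝔬.blkW hG.lenle 0) (𝔬.Dvstar U ∘ₗ (𝔬.G0 U ∘ₗ 𝔬.Dv U))
      (fun a b => BdD * Real.exp (-(δ₃ * (geo9Y x).dist a b))) := by
  letI : Fintype (geo9K x.toKIdx).Site := (inferInstance : Fintype (geo9Y x).Site)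
  have hDv' : 𝔬.Dv U = ∑ μ, Dds μ ∘ₗ JcoKH x.toKIdx (trBasis N) (bg9Y (Matrix (Fin N) (Fin N) ℂ) (specialUnitaryUnits (Fin N)) x) (fun U => U) μ U := by
    rw [hDv, hDds]
    exact DvcoKH_eq_sum x.toKIdx (trBasis N) (bg9Y (Matrix (Fin N) (Fin N) ℂ) (specialUnitaryUnits (Fin N)) x) (fun U => U) U
  have hJ : ∀ μ, HasMaj (bHS (κ := TrIdx N) (R := R₀) (H := H₀) x.toKIdx (sIK x.toKIdx bI) ε) (bHK (κ := TrIdx N) (R := R₀) (H := H₀) x.toKIdx bI ε)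
      (JcoKH x.toKIdx (trBasis N) (bg9Y (Matrix (Fin N) (Fin N) ℂ) (specialUnitaryUnits (Fin N)) x) (fun U => U) μ U)
      (fun a b => 2 * (1 + ϑ) * cR39 (trBasis N) * Real.exp (δJ * rJ d ℓ) * Real.exp (-(δJ * (geo9Y x).dist a b))) := fun μ =>
    hasMaj_JcoKH_holder_pins x hβ1 hbI0 hU hε hε1 hϑ hΘ hδJ μ
  have hBdD' : (Fintype.card (Fin (d + 1)) : ℝ) * ((bHK (κ := TrIdx N) (R := R₀) (H := H₀) x.toKIdx bI ε).κ * BiD *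
      (2 * (1 + ϑ) * cR39 (trBasis N) * Real.exp (δJ * rJ d ℓ)) * c) ≤ BdD := by
    rw [Fintype.card_fin, Nat.cast_add, Nat.cast_one]
    exact hBdD
  exact h44DsDv_of_h44Ds hG hrow hBiD (constJH_nonneg hϑ δJ) hδ₃ hδ₃0 hδ₃J hBdD' hDv' h44Ds hJ

/-- ★★ **`Letters313DMZ.dgDHd ν` AT THE PINS WITH `bH13 := weightNorm (bHS (sIK bI) 1) (Lʲη)⁻¹`** — ∇_{U,ν}G₀D_U : bH13 → 𝔠⁽¹⁾, every member, every `Reg335`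
configuration in small-gauge position at the exponent 1 (`hΘ`), from (3.44) for G₀ at the direction letters at `ε = 1` (`h44m μ` = the derived
`Thm33G0Dir.h44m (ν, μ) 1`, input class `bHXA x 1 = bHK bI 1`) and the with-length J-letter (`hasMaj_JcoKH_holder_len`, member facts `Facts347`);
`B₃ ≥ (d+1)·κ₀·B_i·L₀·C_J(ϑ)·L·c` written as stated, `0 ≤ δ₃ ≤ δ₀ − αδ_F`, `δ₃ + σ ≤ δ_J − αδ_F`.
[cite: Balaban1985BackgroundPropagators, Thm 3.3 (3.44) p.398 + (3.152)–(3.153) p.426 + (3.3) p.390 + (3.35) p.396 + p.398 (remarks after (3.47)); Balaban1984PropagatorsII, (2.26) p.228 + (2.52)–(2.56) pp.232–233 + Lemma 2.1 (2.60)–(2.61) p.234] -/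
theorem dgDHd_pins (x : MemberY d ℓ hd hL b₀ b₁ Mstar) {bI : FBondY x.toKIdx → IBondY x.toKIdx}
    (hβ1 : ∀ f : FBondY x.toKIdx, (geomT x.D).dist (β x.hN x.D x.hk (bI f)) (blkV1 x.hN x.D f) ≤ 1)
    (hbI0 : ∀ f : FBondY x.toKIdx, bI f = bI ⟨f.src, 0⟩) {c35 α₀ : ℝ}
    {U : (bg9Y (Matrix (Fin N) (Fin N) ℂ) (specialUnitaryUnits (Fin N)) x).Cfg}
    (hU : (bg9Y (Matrix (Fin N) (Fin N) ℂ) (specialUnitaryUnits (Fin N)) x).Reg335 c35 α₀ U) {ϑ : ℝ} (hϑ : 0 ≤ ϑ)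
    (hΘ : ∀ (μ : Fin (d + 1)) (s s' : Site (PV d ℓ x.toKIdx.m x.toKIdx.K hd hL) 0), Adm x.toKIdx ⟨s, μ⟩ ⟨s', μ⟩ →
      tpar x.toKIdx ⟨s, μ⟩ ⟨s', μ⟩ ^ (-(1 : ℝ)) * ‖(U μ s : Matrix (Fin N) (Fin N) ℂ) - (U μ s' : Matrix (Fin N) (Fin N) ℂ)‖ ≤ ϑ)
    {R₀ : ℝ} {H₀ : Prop} (hG : GeoOK (geo9Y x)) {σ c : ℝ} (hrow : RowSum (toB6 (geo9Y x) R₀ H₀) σ c)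
    {dF : ℕ} {δF α L₀ : ℝ} (hF : Facts347 (geo9Y x) R₀ H₀ dF δF α L₀)
    (𝔬 : Ops (geo9Y x) (bg9Y (Matrix (Fin N) (Fin N) ℂ) (specialUnitaryUnits (Fin N)) x) (XBK (TrIdx N) x.toKIdx) (XBK (TrIdx N) x.toKIdx)
      (XHK (TrIdx N) x.toKIdx) (XSK (TrIdx N) x.toKIdx))
    (hDv : 𝔬.Dv U = DvcoKH x.toKIdx (trBasis N) (bg9Y (Matrix (Fin N) (Fin N) ℂ) (specialUnitaryUnits (Fin N)) x) (fun U => U) U)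
    {Dds : Fin (d + 1) → Module.End ℝ (XBK (TrIdx N) x.toKIdx → ℝ)}
    (hDds : Dds = fun μ => coordOpK (trBasis N) (fun _ : Fin (d + 1) => cdsBₗ x.toKIdx U μ))
    {Ddν : Module.End ℝ (XBK (TrIdx N) x.toKIdx → ℝ)}
    {Bi δ₀ δJ κ₀ B₃ δ₃ : ℝ} (hBi : 0 ≤ Bi) (hc : 0 ≤ c) (hδJ : 0 ≤ δJ)
    (hκ : letI : Fintype (geo9K x.toKIdx).Site := (inferInstance : Fintype (geo9Y x).Site); (bHK (κ := TrIdx N) (R := R₀) (H := H₀) x.toKIdx bI 1).κ ≤ κ₀)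
    (hδ₃ : 0 ≤ δ₃) (hδ₃0 : δ₃ ≤ δ₀ - α * δF) (hδ₃J : δ₃ + σ ≤ (δJ - α * δF))
    (hB₃ : ((d : ℝ) + 1) * (κ₀ * (Bi * L₀) * (2 * (1 + ϑ) * cR39 (trBasis N) * Real.exp (δJ * rJ d ℓ) * (geo9Y x).L) * c) ≤ B₃)
    (h44m : ∀ μ, letI : Fintype (geo9K x.toKIdx).Site := (inferInstance : Fintype (geo9Y x).Site)
      HasMaj (bHK (κ := TrIdx N) (R := R₀) (H := H₀) x.toKIdx bI 1) (BlockNorm.ofBlocks (toB6 (geo9Y x) R₀ H₀) 𝔬.blk) (Ddν ∘ₗ (𝔬.G0 U ∘ₗ Dds μ))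
        (fun a b => Bi * Real.exp (-(δ₀ * (geo9Y x).dist a b)))) :
    letI : Fintype (geo9K x.toKIdx).Site := (inferInstance : Fintype (geo9Y x).Site)
    HasMaj (weightNorm (bHS (κ := TrIdx N) (R := R₀) (H := H₀) x.toKIdx (sIK x.toKIdx bI) 1) (fun y => ((geo9Y x).len y)⁻¹) fun y => inv_nonneg.mpr (hG.lenle y))
      (cNorm R₀ H₀ 𝔬.blk hG.lenle 1) (Ddν ∘ₗ 𝔬.G0 U ∘ₗ 𝔬.Dv U) (fun a b => B₃ * Real.exp (-(δ₃ * (geo9Y x).dist a b))) := by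
  letI : Fintype (geo9K x.toKIdx).Site := (inferInstance : Fintype (geo9Y x).Site)
  have hDv' : 𝔬.Dv U = ∑ μ, Dds μ ∘ₗ JcoKH x.toKIdx (trBasis N) (bg9Y (Matrix (Fin N) (Fin N) ℂ) (specialUnitaryUnits (Fin N)) x) (fun U => U) μ U := by
    rw [hDv, hDds]
    exact DvcoKH_eq_sum x.toKIdx (trBasis N) (bg9Y (Matrix (Fin N) (Fin N) ℂ) (specialUnitaryUnits (Fin N)) x) (fun U => U) U
  have hJ : ∀ μ, HasMaj (weightNorm (bHS (κ := TrIdx N) (R := R₀) (H := H₀) x.toKIdx (sIK x.toKIdx bI) 1) (fun y => ((geo9Y x).len y)⁻¹)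
        fun y => inv_nonneg.mpr (hG.lenle y)) (bHK (κ := TrIdx N) (R := R₀) (H := H₀) x.toKIdx bI 1)
      (JcoKH x.toKIdx (trBasis N) (bg9Y (Matrix (Fin N) (Fin N) ℂ) (specialUnitaryUnits (Fin N)) x) (fun U => U) μ U)
      (fun a b => 2 * (1 + ϑ) * cR39 (trBasis N) * Real.exp (δJ * rJ d ℓ) * (geo9Y x).L * (geo9Y x).len a *
        Real.exp (-((δJ - α * δF) * (geo9Y x).dist a b))) := fun μ =>
    hasMaj_JcoKH_holder_len x.toKIdx (trBasis N) (bg9Y (Matrix (Fin N) (Fin N) ℂ) (specialUnitaryUnits (Fin N)) x) (fun U => U) hG hF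
      hβ1 hbI0 (B9GradViaDivLettersAtPins.cfg_norm_le_one_of_reg335 x hU) zero_le_one le_rfl hϑ hΘ hδJ μ
  have hB₃' : (Fintype.card (Fin (d + 1)) : ℝ) * (κ₀ * (Bi * L₀) * (2 * (1 + ϑ) * cR39 (trBasis N) * Real.exp (δJ * rJ d ℓ) * (geo9Y x).L) * c) ≤ B₃ := by
    rw [Fintype.card_fin, Nat.cast_add, Nat.cast_one]
    exact hB₃
  have hCJ : 0 ≤ 2 * (1 + ϑ) * cR39 (trBasis N) * Real.exp (δJ * rJ d ℓ) * (geo9Y x).L :=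
    mul_nonneg (constJH_nonneg hϑ δJ) (le_trans zero_le_one hF.one_le_L)
  exact dgDHd_of_h44m hG hrow hF hBi hCJ hc hκ hδ₃ hδ₃0 hδ₃J hB₃' hDv' h44m hJ

/-- ★★ **`Letters313DZ.dgDH` AT THE PINS WITH `bH13 := weightNorm (bHS (sIK bI) 1) (Lʲη)⁻¹`** — ∇_UG₀D_U : bH13 → 𝔠_Y⁽¹⁾ with the slice-diagonal `∇_U` of the
letters (`hD`: def-Y's `DcoK = Σ_ν Π_ν ∘ ∇_{U,ν}`, p612121 `DcoK_eq_sum`; the Π-letter `hasMaj_sliceProjK_cNorm`), every member, every `Reg335` configuration in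
small-gauge position at the exponent 1, from `h44m ν μ` (the derived `Thm33G0Dir.h44m (ν, μ) 1`) and the with-length J-letter: `dgDHd_pins`'s constant `B₃` per ν,
then `B₃p ≥ (d+1)·B₃·c` at the same rate `δ₃` (the Π-letter is exactly local, its rate is free).
[cite: Balaban1985BackgroundPropagators, Thm 3.13 p.426 + Thm 3.3 (3.44) p.398 + (3.42) p.397 («∇_UG(U)») + (3.152)–(3.153) p.426 + (3.3) p.390; Balaban1984PropagatorsII, (2.26) p.228 + (2.52)–(2.56) pp.232–233 + Lemma 2.1 (2.60)–(2.61) p.234] -/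
theorem dgDH_pins (x : MemberY d ℓ hd hL b₀ b₁ Mstar) {bI : FBondY x.toKIdx → IBondY x.toKIdx}
    (hβ1 : ∀ f : FBondY x.toKIdx, (geomT x.D).dist (β x.hN x.D x.hk (bI f)) (blkV1 x.hN x.D f) ≤ 1)
    (hbI0 : ∀ f : FBondY x.toKIdx, bI f = bI ⟨f.src, 0⟩) {c35 α₀ : ℝ}
    {U : (bg9Y (Matrix (Fin N) (Fin N) ℂ) (specialUnitaryUnits (Fin N)) x).Cfg}
    (hU : (bg9Y (Matrix (Fin N) (Fin N) ℂ) (specialUnitaryUnits (Fin N)) x).Reg335 c35 α₀ U) {ϑ : ℝ} (hϑ : 0 ≤ ϑ)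
    (hΘ : ∀ (μ : Fin (d + 1)) (s s' : Site (PV d ℓ x.toKIdx.m x.toKIdx.K hd hL) 0), Adm x.toKIdx ⟨s, μ⟩ ⟨s', μ⟩ →
      tpar x.toKIdx ⟨s, μ⟩ ⟨s', μ⟩ ^ (-(1 : ℝ)) * ‖(U μ s : Matrix (Fin N) (Fin N) ℂ) - (U μ s' : Matrix (Fin N) (Fin N) ℂ)‖ ≤ ϑ)
    {R₀ : ℝ} {H₀ : Prop} (hG : GeoOK (geo9Y x)) {σ c : ℝ} (hrow : RowSum (toB6 (geo9Y x) R₀ H₀) σ c)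
    {dF : ℕ} {δF α L₀ : ℝ} (hF : Facts347 (geo9Y x) R₀ H₀ dF δF α L₀)
    (𝔬 : Ops (geo9Y x) (bg9Y (Matrix (Fin N) (Fin N) ℂ) (specialUnitaryUnits (Fin N)) x) (XBK (TrIdx N) x.toKIdx) (XBK (TrIdx N) x.toKIdx)
      (XHK (TrIdx N) x.toKIdx) (XSK (TrIdx N) x.toKIdx))
    (hblk : 𝔬.blk = blkBK x.toKIdx bI) (hblkY : 𝔬.blkY = blkBK x.toKIdx bI)
    (hDv : 𝔬.Dv U = DvcoKH x.toKIdx (trBasis N) (bg9Y (Matrix (Fin N) (Fin N) ℂ) (specialUnitaryUnits (Fin N)) x) (fun U => U) U)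
    (hD : 𝔬.D U = B9CoReadingCoords.DcoK x.toKIdx (trBasis N) (bg9Y (Matrix (Fin N) (Fin N) ℂ) (specialUnitaryUnits (Fin N)) x) (fun U => U) U)
    {Dd Dds : Fin (d + 1) → Module.End ℝ (XBK (TrIdx N) x.toKIdx → ℝ)}
    (hDd : Dd = fun ν => coordOpK (trBasis N) (fun _ : Fin (d + 1) => cdBₗ x.toKIdx U ν))
    (hDds : Dds = fun μ => coordOpK (trBasis N) (fun _ : Fin (d + 1) => cdsBₗ x.toKIdx U μ))
    {Bi δ₀ δJ κ₀ B₃ δ₃ B₃p : ℝ} (hBi : 0 ≤ Bi) (hc : 0 ≤ c) (hδJ : 0 ≤ δJ)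
    (hκ : letI : Fintype (geo9K x.toKIdx).Site := (inferInstance : Fintype (geo9Y x).Site); (bHK (κ := TrIdx N) (R := R₀) (H := H₀) x.toKIdx bI 1).κ ≤ κ₀)
    (hδ₃ : 0 ≤ δ₃) (hδ₃0 : δ₃ ≤ δ₀ - α * δF) (hδ₃J : δ₃ + σ ≤ (δJ - α * δF))
    (hB₃ : ((d : ℝ) + 1) * (κ₀ * (Bi * L₀) * (2 * (1 + ϑ) * cR39 (trBasis N) * Real.exp (δJ * rJ d ℓ) * (geo9Y x).L) * c) ≤ B₃)
    (hB₃p : ((d : ℝ) + 1) * (1 * B₃ * c) ≤ B₃p)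
    (h44m : ∀ ν μ, letI : Fintype (geo9K x.toKIdx).Site := (inferInstance : Fintype (geo9Y x).Site)
      HasMaj (bHK (κ := TrIdx N) (R := R₀) (H := H₀) x.toKIdx bI 1) (BlockNorm.ofBlocks (toB6 (geo9Y x) R₀ H₀) 𝔬.blk) (Dd ν ∘ₗ (𝔬.G0 U ∘ₗ Dds μ))
        (fun a b => Bi * Real.exp (-(δ₀ * (geo9Y x).dist a b)))) :
    letI : Fintype (geo9K x.toKIdx).Site := (inferInstance : Fintype (geo9Y x).Site)
    HasMaj (weightNorm (bHS (κ := TrIdx N) (R := R₀) (H := H₀) x.toKIdx (sIK x.toKIdx bI) 1) (fun y => ((geo9Y x).len y)⁻¹) fun y => inv_nonneg.mpr (hG.lenle y))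
      (cNorm R₀ H₀ 𝔬.blkY hG.lenle 1) (𝔬.D U ∘ₗ 𝔬.G0 U ∘ₗ 𝔬.Dv U) (fun a b => B₃p * Real.exp (-(δ₃ * (geo9Y x).dist a b))) := by
  letI : Fintype (geo9K x.toKIdx).Site := (inferInstance : Fintype (geo9Y x).Site)
  have hDv' : 𝔬.Dv U = ∑ μ, Dds μ ∘ₗ JcoKH x.toKIdx (trBasis N) (bg9Y (Matrix (Fin N) (Fin N) ℂ) (specialUnitaryUnits (Fin N)) x) (fun U => U) μ U := by
    rw [hDv, hDds]
    exact DvcoKH_eq_sum x.toKIdx (trBasis N) (bg9Y (Matrix (Fin N) (Fin N) ℂ) (specialUnitaryUnits (Fin N)) x) (fun U => U) U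
  have hD' : 𝔬.D U = ∑ ν, sliceProjK ν ∘ₗ Dd ν := by
    rw [hD, hDd]
    exact DcoK_eq_sum x.toKIdx (trBasis N) (bg9Y (Matrix (Fin N) (Fin N) ℂ) (specialUnitaryUnits (Fin N)) x) (fun U => U) U
  have hJ : ∀ μ, HasMaj (weightNorm (bHS (κ := TrIdx N) (R := R₀) (H := H₀) x.toKIdx (sIK x.toKIdx bI) 1) (fun y => ((geo9Y x).len y)⁻¹)
        fun y => inv_nonneg.mpr (hG.lenle y)) (bHK (κ := TrIdx N) (R := R₀) (H := H₀) x.toKIdx bI 1)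
      (JcoKH x.toKIdx (trBasis N) (bg9Y (Matrix (Fin N) (Fin N) ℂ) (specialUnitaryUnits (Fin N)) x) (fun U => U) μ U)
      (fun a b => 2 * (1 + ϑ) * cR39 (trBasis N) * Real.exp (δJ * rJ d ℓ) * (geo9Y x).L * (geo9Y x).len a *
        Real.exp (-((δJ - α * δF) * (geo9Y x).dist a b))) := fun μ =>
    hasMaj_JcoKH_holder_len x.toKIdx (trBasis N) (bg9Y (Matrix (Fin N) (Fin N) ℂ) (specialUnitaryUnits (Fin N)) x) (fun U => U) hG hF
      hβ1 hbI0 (B9GradViaDivLettersAtPins.cfg_norm_le_one_of_reg335 x hU) zero_le_one le_rfl hϑ hΘ hδJ μ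
  have hPr : ∀ ν, HasMaj (cNorm R₀ H₀ 𝔬.blk hG.lenle 1) (cNorm R₀ H₀ 𝔬.blkY hG.lenle 1) (sliceProjK (κ := TrIdx N) ν)
      (fun a b => (1 : ℝ) * Real.exp (-((δ₃ + σ) * (geo9Y x).dist a b))) := fun ν => by
    rw [hblk, hblkY]
    exact hasMaj_sliceProjK_cNorm x.toKIdx (blkBK x.toKIdx bI) hG.lenle 1 ν
  have hB₃a : (Fintype.card (Fin (d + 1)) : ℝ) * (κ₀ * (Bi * L₀) * (2 * (1 + ϑ) * cR39 (trBasis N) * Real.exp (δJ * rJ d ℓ) * (geo9Y x).L) * c) ≤ B₃ := by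
    rw [Fintype.card_fin, Nat.cast_add, Nat.cast_one]
    exact hB₃
  have hB₃b : (Fintype.card (Fin (d + 1)) : ℝ) * (1 * B₃ * c) ≤ B₃p := by
    rw [Fintype.card_fin, Nat.cast_add, Nat.cast_one]
    exact hB₃p
  have hCJ : 0 ≤ 2 * (1 + ϑ) * cR39 (trBasis N) * Real.exp (δJ * rJ d ℓ) * (geo9Y x).L :=
    mul_nonneg (constJH_nonneg hϑ δJ) (le_trans zero_le_one hF.one_le_L)
  exact dgDH_of_h44m hG hrow hF hBi hCJ zero_le_one hc hκ hδ₃ hδ₃0 hδ₃J hB₃a hδ₃ le_rfl le_rfl hB₃b hDv' hD' h44m hJ hPr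

/-- ★★ **`Letters313HZ.pYDH β` AT THE PINS WITH `bH13 := weightNorm (bHS (sIK bI) 1) (Lʲη)⁻¹`** — Φ^Y_β∘∇_U∘G₀∘D_U : bH13 → 𝔠_{P_Y}^{(β−1)}, every member, every `Reg335`
configuration in small-gauge position at the exponent 1, from a directional Φ^Y-(3.45) member at the input class `bHK bI 1` (`h45Y` — supplied at the pins by n06-w6's
`B9Thm33G0ProbeYFromDirAtPins.h45Y_of_thm33G0Dir_pins … μ (1 − β) β` after `β + (1 − β) = 1`) and the with-length J-letter `hasMaj_JcoKH_holder_len … (ε := 1)`: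
`BhD ≥ (d+1)·κ₀·B_i·L₀·C_J(ϑ)·L·c`, `δ₃ ≤ δ₀ − αδ_F`, `δ₃ + σ ≤ δ_J − αδ_F`.
[cite: Balaban1985BackgroundPropagators, Thm 3.13 p.426 + (3.45) p.398 + (3.152)–(3.153) p.426 + (3.3) p.390 + (3.35) p.396 + p.398 (remarks after (3.47)); Balaban1984PropagatorsII, (2.26) p.228 + (2.52)–(2.56) pp.232–233 + Lemma 2.1 (2.60)–(2.61) p.234] -/
theorem pYDH_pins (x : MemberY d ℓ hd hL b₀ b₁ Mstar) {bI : FBondY x.toKIdx → IBondY x.toKIdx}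
    (hβ1 : ∀ f : FBondY x.toKIdx, (geomT x.D).dist (β x.hN x.D x.hk (bI f)) (blkV1 x.hN x.D f) ≤ 1)
    (hbI0 : ∀ f : FBondY x.toKIdx, bI f = bI ⟨f.src, 0⟩) {c35 α₀ : ℝ}
    {U : (bg9Y (Matrix (Fin N) (Fin N) ℂ) (specialUnitaryUnits (Fin N)) x).Cfg}
    (hU : (bg9Y (Matrix (Fin N) (Fin N) ℂ) (specialUnitaryUnits (Fin N)) x).Reg335 c35 α₀ U) {ϑ : ℝ} (hϑ : 0 ≤ ϑ)
    (hΘ : ∀ (μ : Fin (d + 1)) (s s' : Site (PV d ℓ x.toKIdx.m x.toKIdx.K hd hL) 0), Adm x.toKIdx ⟨s, μ⟩ ⟨s', μ⟩ →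
      tpar x.toKIdx ⟨s, μ⟩ ⟨s', μ⟩ ^ (-(1 : ℝ)) * ‖(U μ s : Matrix (Fin N) (Fin N) ℂ) - (U μ s' : Matrix (Fin N) (Fin N) ℂ)‖ ≤ ϑ)
    {R₀ : ℝ} {H₀ : Prop} (hG : GeoOK (geo9Y x)) {σ c : ℝ} (hrow : RowSum (toB6 (geo9Y x) R₀ H₀) σ c)
    {dF : ℕ} {δF α L₀ : ℝ} (hF : Facts347 (geo9Y x) R₀ H₀ dF δF α L₀) {PX PY : Type} [Fintype PX] [Fintype PY]
    (𝔬 : Ops (geo9Y x) (bg9Y (Matrix (Fin N) (Fin N) ℂ) (specialUnitaryUnits (Fin N)) x) (XBK (TrIdx N) x.toKIdx) (XBK (TrIdx N) x.toKIdx)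
      (XHK (TrIdx N) x.toKIdx) (XSK (TrIdx N) x.toKIdx))
    (𝔭 : HolderProbes (geo9Y x) (bg9Y (Matrix (Fin N) (Fin N) ℂ) (specialUnitaryUnits (Fin N)) x) (XBK (TrIdx N) x.toKIdx) (XBK (TrIdx N) x.toKIdx) PX PY)
    (hDv : 𝔬.Dv U = DvcoKH x.toKIdx (trBasis N) (bg9Y (Matrix (Fin N) (Fin N) ℂ) (specialUnitaryUnits (Fin N)) x) (fun U => U) U)
    {Dds : Fin (d + 1) → Module.End ℝ (XBK (TrIdx N) x.toKIdx → ℝ)}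
    (hDds : Dds = fun μ => coordOpK (trBasis N) (fun _ : Fin (d + 1) => cdsBₗ x.toKIdx U μ))
    {βH Bi δ₀ δJ κ₀ BhD δ₃ : ℝ} (hBi : 0 ≤ Bi) (hc : 0 ≤ c) (hδJ : 0 ≤ δJ)
    (hκ : letI : Fintype (geo9K x.toKIdx).Site := (inferInstance : Fintype (geo9Y x).Site); (bHK (κ := TrIdx N) (R := R₀) (H := H₀) x.toKIdx bI 1).κ ≤ κ₀)
    (hδ₃ : 0 ≤ δ₃) (hδ₃0 : δ₃ ≤ δ₀ - α * δF) (hδ₃J : δ₃ + σ ≤ (δJ - α * δF))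
    (hBhD : ((d : ℝ) + 1) * (κ₀ * (Bi * L₀) * (2 * (1 + ϑ) * cR39 (trBasis N) * Real.exp (δJ * rJ d ℓ) * (geo9Y x).L) * c) ≤ BhD)
    (h45Y : ∀ μ, letI : Fintype (geo9K x.toKIdx).Site := (inferInstance : Fintype (geo9Y x).Site)
      HasMaj (bHK (κ := TrIdx N) (R := R₀) (H := H₀) x.toKIdx bI 1) (BlockNorm.ofBlocks (toB6 (geo9Y x) R₀ H₀) 𝔭.blkPY)
        (𝔭.ΦY U βH ∘ₗ (𝔬.D U ∘ₗ (𝔬.G0 U ∘ₗ Dds μ))) (fun a b => Bi * (geo9Y x).len a ^ (-βH) * Real.exp (-(δ₀ * (geo9Y x).dist a b)))) :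
    letI : Fintype (geo9K x.toKIdx).Site := (inferInstance : Fintype (geo9Y x).Site)
    HasMaj (weightNorm (bHS (κ := TrIdx N) (R := R₀) (H := H₀) x.toKIdx (sIK x.toKIdx bI) 1) (fun y => ((geo9Y x).len y)⁻¹) fun y => inv_nonneg.mpr (hG.lenle y))
      (cNormR R₀ H₀ 𝔭.blkPY hG.lenle (βH - 1)) ((𝔭.ΦY U βH ∘ₗ 𝔬.D U ∘ₗ 𝔬.G0 U) ∘ₗ 𝔬.Dv U)
      (fun a b => BhD * Real.exp (-(δ₃ * (geo9Y x).dist a b))) := by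
  letI : Fintype (geo9K x.toKIdx).Site := (inferInstance : Fintype (geo9Y x).Site)
  have hDv' : 𝔬.Dv U = ∑ μ, Dds μ ∘ₗ JcoKH x.toKIdx (trBasis N) (bg9Y (Matrix (Fin N) (Fin N) ℂ) (specialUnitaryUnits (Fin N)) x) (fun U => U) μ U := by
    rw [hDv, hDds]
    exact DvcoKH_eq_sum x.toKIdx (trBasis N) (bg9Y (Matrix (Fin N) (Fin N) ℂ) (specialUnitaryUnits (Fin N)) x) (fun U => U) U
  have hJ : ∀ μ, HasMaj (weightNorm (bHS (κ := TrIdx N) (R := R₀) (H := H₀) x.toKIdx (sIK x.toKIdx bI) 1) (fun y => ((geo9Y x).len y)⁻¹)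
        fun y => inv_nonneg.mpr (hG.lenle y)) (bHK (κ := TrIdx N) (R := R₀) (H := H₀) x.toKIdx bI 1)
      (JcoKH x.toKIdx (trBasis N) (bg9Y (Matrix (Fin N) (Fin N) ℂ) (specialUnitaryUnits (Fin N)) x) (fun U => U) μ U)
      (fun a b => 2 * (1 + ϑ) * cR39 (trBasis N) * Real.exp (δJ * rJ d ℓ) * (geo9Y x).L * (geo9Y x).len a *
        Real.exp (-((δJ - α * δF) * (geo9Y x).dist a b))) := fun μ =>
    hasMaj_JcoKH_holder_len x.toKIdx (trBasis N) (bg9Y (Matrix (Fin N) (Fin N) ℂ) (specialUnitaryUnits (Fin N)) x) (fun U => U) hG hF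
      hβ1 hbI0 (B9GradViaDivLettersAtPins.cfg_norm_le_one_of_reg335 x hU) zero_le_one le_rfl hϑ hΘ hδJ μ
  have hBhD' : (Fintype.card (Fin (d + 1)) : ℝ) * (κ₀ * (Bi * L₀) * (2 * (1 + ϑ) * cR39 (trBasis N) * Real.exp (δJ * rJ d ℓ) * (geo9Y x).L) * c) ≤ BhD := by
    rw [Fintype.card_fin, Nat.cast_add, Nat.cast_one]
    exact hBhD
  have hCJ : 0 ≤ 2 * (1 + ϑ) * cR39 (trBasis N) * Real.exp (δJ * rJ d ℓ) * (geo9Y x).L :=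
    mul_nonneg (constJH_nonneg hϑ δJ) (le_trans zero_le_one hF.one_le_L)
  exact pYDH_of_h45Y hG hrow hF hBi hCJ hc hκ hδ₃ hδ₃0 hδ₃J hBhD' hDv' h45Y hJ

end Members

end Literature.MathematicalPhysics.QuantumFieldTheory.Balaban1983to89.B9Thm313WholeDvHolderAtPins

end
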